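import Summits.HodgeConjecture.HodgeConjecture.Theses.TropicalCuspLift
import Literature.AlgebraicGeometry.HodgeTheory.WeilClassesFourfolds
import Literature.AlgebraicGeometry.HodgeTheory.WeilClassesSixfolds

/-!
# `WeilSixfolds` (stmt-HodgeConjecture-2524) · what the crux reduces to, kernel-checked

Route `TropicalCuspLift`, crux `WeilSixfolds` = X(3): every rational `(3,3)`-class in the Weil plane
`E₊ ⊔ E₋ ⊆ H⁶(A(ℂ); ℂ)` of a complex abelian sixfold `A` with `φ ≫ φ = -d` is algebraic. This is an
OPEN PROBLEM off the hyperbolic (discriminant `-1`) components (arXiv:2603.20268, p. 3: "outside this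
locus, the Hodge conjecture for Weil classes on sixfolds remains completely open"); the hyperbolic
components are Markman's theorem (arXiv:2502.03415, Thm. 1.5.1), vendored in the tree as the named
facts `Markman2025_weilClasses_algebraic_hyperbolicSixfold` (and `…_hyperbolicSixfold`).

Nothing here proves the crux. This file records, on the tree's real carriers and against the route
decls BY NAME, exactly what the item hinges on:

* `weilSixfolds_iff` — the crux restated over the Literature Weil plane `weilClassesOf A φ 3 d`
  (`mem_weilClassesOf_iff`), the shape in which every Literature fact about Weil classes is typed.
* `weilSixfolds_of_hodgeConjecture`, `weilSixfolds_of_weilClassesAlgebraic` — upper bounds: the crux is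
  an instance of the summit statement and of the route's target `WeilClassesAlgebraic` (`n = 3`).
* `weilSixfolds_of_weilFourfoldsBase_of_stepTwo` — the route's own reduction, sharpened: X(3) follows
  from the base `WeilFourfoldsBase` (= X(2)) and the SINGLE instance `n = 2` of `WittTowerStep`;
  `weilFourfoldsBase_of_markman` discharges the base from the vendored fact
  `Markman2025_weilClasses_algebraic_abelianFourfold` (Markman, arXiv:2509.23403 Thm. 1.2), so
  `weilSixfolds_of_markman_of_wittTowerStep` : Markman's fourfold theorem + `WittTowerStep` ⇒ crux —
  the item is `blocked-on` the crux `WittTowerStep` (stmt-HodgeConjecture-2523) and nothing else.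
* `weilSixfolds_of_markmanSplit_of_nonHyperbolic` / `nonHyperbolic_of_weilSixfolds` — the split by
  discriminant: GIVEN Markman's split-sixfold theorem, the crux is EQUIVALENT to its restriction to the
  pairs `(A, φ)` that admit no hyperbolic `K`-symmetrised hyperplane class
  `h = d·ι^*a + φ^*ι^*a` (`Motives.IsHyperbolicWeilType A φ 3 h`, i.e. `det H ≠ -1` for every such
  polarization class) — the genuinely open residual (`weilSixfolds_iff_nonHyperbolic_of_markmanSplit`).
-/

noncomputable section

-- every declaration of this problem lives in `Summit.HodgeConjecture.HodgeConjecture.…` (summit = sub-problem)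
set_option linter.dupNamespace false

open CategoryTheory
open Literature.AlgebraicGeometry Literature.AlgebraicGeometry.HodgeTheory
open Literature.AlgebraicTopology.SingularHomology
open Summit.HodgeConjecture.HodgeConjecture.Theses.TropicalCuspLift

namespace Summit.HodgeConjecture.HodgeConjecture.Theorems

/-! ### The crux over the Literature Weil plane -/

/-- **`WeilSixfolds` restated over `weilClassesOf`**: the crux's inlined Weil-plane membership
`c = c₁ + c₂`, `c₁ ∈ E₊`, `c₂ ∈ E₋` is literally `c ∈ weilClassesOf A φ 3 d`
(`mem_weilClassesOf_iff`), so the crux reads: for `0 < d`, `A` a smooth projective complex abelian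
variety of dimension `6`, `φ ≫ φ = -(d • 𝟙 A)`, every rational class of Hodge type `(3,3)` in
`weilClassesOf A φ 3 d ⊆ H⁶(A(ℂ); ℂ)` lies in `algebraicClasses A.X 3`. -/
theorem weilSixfolds_iff :
    WeilSixfolds ↔
      ∀ (d : ℕ), 0 < d → ∀ (A : Motives.AbelianVariety ℂ) (φ : A ⟶ A), A.dim = 2 * 3 →
        Motives.IsSmoothProjective (2 * 3) A.X → φ ≫ φ = -(d • 𝟙 A) →
          ∀ c : complexBetti A.X (2 * 3), IsRationalClass c → IsOfHodgeType (2 * 3) A.X (2 * 3) 3 3 c →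
            c ∈ weilClassesOf A φ 3 d → c ∈ algebraicClasses A.X 3 := by
  unfold WeilSixfolds
  refine ⟨fun h d hd A φ hA hX hφ c hc h33 hW ↦ h d hd A φ hA hX hφ c hc h33 (mem_weilClassesOf_iff.1 hW),
    fun h d hd A φ hA hX hφ c hc h33 hW ↦ h d hd A φ hA hX hφ c hc h33 (mem_weilClassesOf_iff.2 hW)⟩

/-! ### Upper bounds: the crux is an instance of the summit and of the route's target -/

/-- **The summit statement implies the crux**: `WeilSixfolds` is the instance of `HodgeConjecture`
over smooth projective abelian sixfolds in codimension `3`, restricted to the Weil plane (nothing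
stronger than the summit is claimed by the item). -/
theorem weilSixfolds_of_hodgeConjecture (h : _root_.HodgeConjecture) : WeilSixfolds := by
  unfold WeilSixfolds
  intro d _ A φ _ hX _ c hc h33 _
  exact (h hX).2 3 c hc h33

/-- **The route's target implies the crux**: `WeilSixfolds` is `WeilClassesAlgebraic` at `n = 3`. -/
theorem weilSixfolds_of_weilClassesAlgebraic (h : WeilClassesAlgebraic) : WeilSixfolds := by
  unfold WeilSixfolds
  exact h 3 (by norm_num)

/-! ### The route's reduction: base `X(2)` + the tower step at `n = 2` -/

/-- **X(3) from X(2) and the single tower step `n = 2`**: `WeilSixfolds` follows from the base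
`WeilFourfoldsBase` and the instance `n = 2` of `WittTowerStep` (spelled out: X(2) → X(3), with the
dimensions written `2 * 2` and `2 * (2 + 1)` as in the route decl). Only this one instance of the
step is used by the crux. -/
theorem weilSixfolds_of_weilFourfoldsBase_of_stepTwo (hbase : WeilFourfoldsBase)
    (hstep : WeilFourfoldsBase →
      ∀ (d : ℕ), 0 < d → ∀ (A : Motives.AbelianVariety ℂ) (φ : A ⟶ A), A.dim = 2 * (2 + 1) →
        Motives.IsSmoothProjective (2 * (2 + 1)) A.X → φ ≫ φ = -(d • 𝟙 A) →
          ∀ c : singularCohomology ℂ ℂ (Motives.ComplexPoints A.X) (2 * (2 + 1)), IsRationalClass c →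
            IsOfHodgeType (2 * (2 + 1)) A.X (2 * (2 + 1)) (2 + 1) (2 + 1) c →
              (∃ c₁ c₂ : singularCohomology ℂ ℂ (Motives.ComplexPoints A.X) (2 * (2 + 1)),
                c = c₁ + c₂ ∧
                (∀ x y : ℕ, singularCohomology.map ℂ ℂ
                    (Motives.AlgPoints.mapContinuous (L := ℂ) (x • 𝟙 A + y • φ).hom.hom.hom)
                      (2 * (2 + 1)) c₁ =
                  ((x : ℂ) + (y : ℂ) * Complex.I * (Real.sqrt d : ℂ)) ^ (2 * (2 + 1)) • c₁) ∧
                (∀ x y : ℕ, singularCohomology.map ℂ ℂ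
                    (Motives.AlgPoints.mapContinuous (L := ℂ) (x • 𝟙 A + y • φ).hom.hom.hom)
                      (2 * (2 + 1)) c₂ =
                  ((x : ℂ) - (y : ℂ) * Complex.I * (Real.sqrt d : ℂ)) ^ (2 * (2 + 1)) • c₂)) →
                c ∈ algebraicClasses A.X (2 + 1)) :
    WeilSixfolds := by
  unfold WeilSixfolds
  exact hstep hbase

/-- **Base + tower step ⇒ crux** in the route's own decls: `WeilFourfoldsBase → WittTowerStep →
WeilSixfolds`, using `WittTowerStep` only at `n = 2`. -/
theorem weilSixfolds_of_weilFourfoldsBase_of_wittTowerStep (hbase : WeilFourfoldsBase)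
    (hstep : WittTowerStep) : WeilSixfolds :=
  weilSixfolds_of_weilFourfoldsBase_of_stepTwo hbase (hstep 2 le_rfl)

/-- **Markman's fourfold theorem discharges the base**: the vendored named fact
`Markman2025_weilClasses_algebraic_abelianFourfold` (Markman, arXiv:2509.23403 Thm. 1.2 / §11.5
Step 2: Weil classes on abelian fourfolds are algebraic for every `K` and every discriminant) is
`WeilFourfoldsBase` after `mem_weilClassesOf_iff` (its `.shape`). CONDITIONAL on the named fact. -/
theorem weilFourfoldsBase_of_markman (hM : Markman2025_weilClasses_algebraic_abelianFourfold) :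
    WeilFourfoldsBase := by
  unfold WeilFourfoldsBase
  exact Markman2025_weilClasses_algebraic_abelianFourfold.shape hM

/-- **What the item hinges on**: granted Markman's fourfold theorem (named fact), the crux
`WeilSixfolds` follows from the crux `WittTowerStep` (stmt-HodgeConjecture-2523) alone — indeed from
its instance `n = 2`. CONDITIONAL on `Markman2025_weilClasses_algebraic_abelianFourfold`. -/
theorem weilSixfolds_of_markman_of_wittTowerStep (hM : Markman2025_weilClasses_algebraic_abelianFourfold)
    (hstep : WittTowerStep) : WeilSixfolds :=
  weilSixfolds_of_weilFourfoldsBase_of_wittTowerStep (weilFourfoldsBase_of_markman hM) hstep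

/-! ### The split by discriminant: hyperbolic components are print, the rest is the open residual -/

/-- **Hyperbolic components + non-hyperbolic residual ⇒ crux.** Granted Markman's split-sixfold
theorem `Markman2025_weilClasses_algebraic_hyperbolicSixfold` (arXiv:2502.03415 Thm. 1.5.1:
discriminant `-1` = hyperbolic, rendered by `Motives.IsHyperbolicWeilType A φ 3 h` for a
`K`-symmetrised hyperplane class `h = d·ι^*a + φ^*ι^*a`), `WeilSixfolds` follows from its restriction
to the pairs `(A, φ)` admitting NO such hyperbolic class — by cases on the existence of a hyperbolic
`(ι, a)`. CONDITIONAL on the named fact; the residual hypothesis is the open part of the crux. -/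
theorem weilSixfolds_of_markmanSplit_of_nonHyperbolic
    (hS : Markman2025_weilClasses_algebraic_hyperbolicSixfold)
    (hres : ∀ (d : ℕ), 0 < d → ∀ (A : Motives.AbelianVariety ℂ) (φ : A ⟶ A), A.dim = 2 * 3 →
      Motives.IsSmoothProjective (2 * 3) A.X → φ ≫ φ = -(d • 𝟙 A) →
        (∀ (e : Motives.ProjectiveEmbedding A.X) (a : complexBetti (Motives.projectiveSpace e.n ℂ) 2),
          IsRationalClass a → a ≠ 0 →
            ¬ Motives.IsHyperbolicWeilType A φ 3
              ((d : ℂ) • complexBetti.map e.ι 2 a +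
                complexBetti.map φ.hom.hom.hom 2 (complexBetti.map e.ι 2 a))) →
          ∀ c : complexBetti A.X (2 * 3), IsRationalClass c → IsOfHodgeType (2 * 3) A.X (2 * 3) 3 3 c →
            c ∈ weilClassesOf A φ 3 d → c ∈ algebraicClasses A.X 3) :
    WeilSixfolds := by
  rw [weilSixfolds_iff]
  intro d hd A φ hA hX hφ c hc h33 hW
  by_cases hhyp : ∃ (e : Motives.ProjectiveEmbedding A.X)
      (a : complexBetti (Motives.projectiveSpace e.n ℂ) 2), IsRationalClass a ∧ a ≠ 0 ∧
        Motives.IsHyperbolicWeilType A φ 3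
          ((d : ℂ) • complexBetti.map e.ι 2 a +
            complexBetti.map φ.hom.hom.hom 2 (complexBetti.map e.ι 2 a))
  · obtain ⟨e, a, ha, ha0, hh⟩ := hhyp
    exact hS d hd A φ hA hX hφ e a ha ha0 hh c hc h33 hW
  · push Not at hhyp
    exact hres d hd A φ hA hX hφ (fun e a ha ha0 ↦ hhyp e a ha ha0) c hc h33 hW

/-- **Crux ⇒ non-hyperbolic residual** (the residual is a restriction of the crux). -/
theorem nonHyperbolic_of_weilSixfolds (h : WeilSixfolds) :
    ∀ (d : ℕ), 0 < d → ∀ (A : Motives.AbelianVariety ℂ) (φ : A ⟶ A), A.dim = 2 * 3 →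
      Motives.IsSmoothProjective (2 * 3) A.X → φ ≫ φ = -(d • 𝟙 A) →
        (∀ (e : Motives.ProjectiveEmbedding A.X) (a : complexBetti (Motives.projectiveSpace e.n ℂ) 2),
          IsRationalClass a → a ≠ 0 →
            ¬ Motives.IsHyperbolicWeilType A φ 3
              ((d : ℂ) • complexBetti.map e.ι 2 a +
                complexBetti.map φ.hom.hom.hom 2 (complexBetti.map e.ι 2 a))) →
          ∀ c : complexBetti A.X (2 * 3), IsRationalClass c → IsOfHodgeType (2 * 3) A.X (2 * 3) 3 3 c →
            c ∈ weilClassesOf A φ 3 d → c ∈ algebraicClasses A.X 3 :=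
  fun d hd A φ hA hX hφ _ c hc h33 hW ↦ weilSixfolds_iff.1 h d hd A φ hA hX hφ c hc h33 hW

/-- **Given Markman's split-sixfold theorem, the crux IS its non-hyperbolic residual**:
`WeilSixfolds ↔` (Weil classes are algebraic on every `(A, φ)`, `dim A = 6`, `φ² = -d`, that admits no
hyperbolic `K`-symmetrised hyperplane class). This is the precise open content of
stmt-HodgeConjecture-2524 (arXiv:2603.20268 p. 3). CONDITIONAL on the named fact. -/
theorem weilSixfolds_iff_nonHyperbolic_of_markmanSplit
    (hS : Markman2025_weilClasses_algebraic_hyperbolicSixfold) :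
    WeilSixfolds ↔
      ∀ (d : ℕ), 0 < d → ∀ (A : Motives.AbelianVariety ℂ) (φ : A ⟶ A), A.dim = 2 * 3 →
        Motives.IsSmoothProjective (2 * 3) A.X → φ ≫ φ = -(d • 𝟙 A) →
          (∀ (e : Motives.ProjectiveEmbedding A.X) (a : complexBetti (Motives.projectiveSpace e.n ℂ) 2),
            IsRationalClass a → a ≠ 0 →
              ¬ Motives.IsHyperbolicWeilType A φ 3
                ((d : ℂ) • complexBetti.map e.ι 2 a +
                  complexBetti.map φ.hom.hom.hom 2 (complexBetti.map e.ι 2 a))) →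
            ∀ c : complexBetti A.X (2 * 3), IsRationalClass c → IsOfHodgeType (2 * 3) A.X (2 * 3) 3 3 c →
              c ∈ weilClassesOf A φ 3 d → c ∈ algebraicClasses A.X 3 :=
  ⟨nonHyperbolic_of_weilSixfolds, weilSixfolds_of_markmanSplit_of_nonHyperbolic hS⟩

end Summit.HodgeConjecture.HodgeConjecture.Theorems

end
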